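import Mathlib
import HarnessLib
import Summits.Ventures.LatticeQCDFlow.Exactness.FlowPushforward
import Summits.Ventures.LatticeQCDFlow.Exactness.U1MaskedLayerJacobian
import Summits.Ventures.LatticeQCDFlow.Scaling.EntropyBudgetCoupling

/-!
# The engine's masked U(1) layer is a coupling layer with CERTIFIED per-link Jacobians: `HasJacobian` on the gauge-field configuration space `ι → U(1)` with product Haar measure

HONEST FRAMING: exact (Metropolis-corrected) sampling algorithms for lattice gauge theory;
figures of merit are autocorrelation/cost numbers at stated couplings and volumes; no
continuum-physics claim.

Venture `LatticeQCDFlow` (cell pub-lqcd), topic `Exactness`; FANOUT row 14 (`eng-flowhmc`, engine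
`latflow.fthmc`, family B).  NEW WORK of the cell; nothing is cited as a fact.  It JOINS two
pieces of the tree:

* row 31's coupling-layer framework `Scaling/EntropyBudgetCoupling.lean` (`Theory2.coupleFun p ψ`:
  the active links `{i // p i}` of `ι → G` are updated by single-link maps `ψ a (U|frozen)`, the
  frozen links `{i // ¬ p i}` unchanged; `Theory2.coupleJac`; **`Theory2.hasJacobian_coupleFun`**:
  such a layer has exact Jacobian `∏_a j a (U|frozen) (U a)` w.r.t. `⊗ᵢ m` PROVIDED every
  single-link map has `HasJacobian m (ψ a y) (ofReal ∘ j a y)` — there (docstring) "the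
  hypothesis an implementation certifies per link", "NOT formalised: the computation of `j` for a
  concrete smooth single-link map from the Haar volume form");
* row 14's certificate `Exactness/U1MaskedLayerJacobian.lean` (`hasJacobian_u1Layer_circle`: for
  `G = U(1) = AddCircle (2π)` with its Haar measure `volume`, the engine's single-link layer map
  `θ ↦ θ + Σ_j c_j sin(α_j − θ)` with contraction indicator `Σ_j |c_j| < 1` has Jacobian
  `1 − Σ_j c_j cos(α_j − θ)`).

## Content

* `AddCircle.forall_coe` — a property of all points of the circle is a property of all
  representatives; `exists_u1Layer_circle_real` / `exists_u1Couple` — the single-link maps and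
  REAL Jacobian factors with the engine's representative formulas exist on the circle
  (`Function.Periodic.lift`; non-vacuity of the hypotheses below).
* **`hasJacobian_u1CoupleFun`** — THE LAYER-LEVEL STATEMENT FOR THE ENGINE'S U(1) MEMBERS
  (`maps.u1_wilson_flow_lo`, `maps.u1_residual` global / CNN-conditioned, twin `ref_u1`): on
  `ι → ℝ/2πℤ` (`ι` any finite index type of links, e.g. the tree's `Edge d L`; reference measure the
  product Haar measure `Measure.pi fun _ => volume`), for any active predicate `p` (in the engine:
  one direction and one parity class), coefficient and angle maps `c a`, `α a` that are measurable
  functions of the FROZEN links (the staple angles, and for CNN members the coefficients — masking)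
  with `Σ_j |c a y j| < 1` for every active `a` and frozen `y`, and single-link maps / factors
  given on representatives by the engine's formulas, the masked layer `Theory2.coupleFun p ψ` has
  `HasJacobian (Measure.pi fun _ => volume) (coupleFun p ψ) (ofReal ∘ coupleJac p jac)` with
  `coupleJac p jac U = ∏_{a active} (1 − Σ_j c_j cos(α_j − θ_a))` — the exponential of the
  engine's layer log-det `Σ_active log(1 − C_ℓ)`.  With `HasJacobian.comp` (layers compose,
  Jacobians multiply) a whole member is certified, which is the hypothesis of
  `flow_reweighting_exact` / `wilson_flow_reweighting_exact` (up to the normalisation of Haar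
  measure) and of `thmc_hmc_exact` (FT-HMC exactness) for the U(1) rung.
* `u1Couple_jac_pos`, **`u1CoupleJac_inv_le`** — the link to row 31's DEPTH LAW: a uniform
  indicator bound `Σ_j |c a y j| ≤ κ₀ < 1` is a per-link clamp `1/j ≤ e^ℓ` with
  `ℓ = −log(1 − κ₀)`, hence (`Theory2.coupleJac_inv_le`) a layer clamp
  `1/J ≤ e^{−log(1 − κ₀) · #active}` — the quantity `n · ℓ · V_a` of
  `Theory2.Lattice.SU2.depth_lower_bound_coupling`-type bounds is, for these layers,
  `depth × (−log(1 − κ)) × #active links`.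

NOT here: SU(N) layers; autocorrelations; any number.
-/

noncomputable section

namespace Summit.Ventures.LatticeQCDFlow.Exactness

open Real Set Function MeasureTheory Summit.Ventures.LatticeQCDFlow.Theory2
open scoped NNReal ENNReal

section U1Coupling

variable {n : ℕ}

/-- A property of all points of the circle is a property of all representatives. -/
theorem AddCircle.forall_coe {T : ℝ} {P : AddCircle T → Prop} (h : ∀ θ : ℝ, P θ) :
    ∀ g, P g := fun g => by
  obtain ⟨θ, rfl⟩ := QuotientAddGroup.mk_surjective g
  exact h θ

/-- The single-link layer map and its REAL Jacobian factor descend to the circle. -/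
theorem exists_u1Layer_circle_real (c α : Fin n → ℝ) :
    ∃ (F : AddCircle (2 * π) → AddCircle (2 * π)) (j : AddCircle (2 * π) → ℝ),
      (∀ θ : ℝ, F θ = ((θ + ∑ k, c k * sin (α k - θ) : ℝ) : AddCircle (2 * π))) ∧
      (∀ θ : ℝ, j θ = 1 - ∑ k, c k * cos (α k - θ)) := by
  have hF : Function.Periodic
      (fun θ : ℝ => ((θ + ∑ k, c k * sin (α k - θ) : ℝ) : AddCircle (2 * π))) (2 * π) := by
    intro θ
    simp only
    rw [u1Layer_add_two_pi c α θ, AddCircle.coe_add_period]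
  have hj : Function.Periodic (fun θ : ℝ => 1 - ∑ k, c k * cos (α k - θ)) (2 * π) := by
    intro θ
    have h : ∀ k, cos (α k - (θ + 2 * π)) = cos (α k - θ) := fun k => by
      rw [sub_add_eq_sub_sub, cos_sub_two_pi]
    simp only [h]
  exact ⟨hF.lift, hj.lift, fun θ => hF.lift_coe θ, fun θ => hj.lift_coe θ⟩

variable {ι : Type*} {p : ι → Prop}

/-- **Non-vacuity**: single-link maps `ψ a y` and real factors `jac a y` with the engine's
representative formulas exist for every active link `a` and frozen configuration `y`. -/
theorem exists_u1Couple
    (c α : {i // p i} → ({i // ¬p i} → AddCircle (2 * π)) → Fin n → ℝ) :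
    ∃ (ψ : {i // p i} → ({i // ¬p i} → AddCircle (2 * π)) → AddCircle (2 * π) → AddCircle (2 * π))
      (jac : {i // p i} → ({i // ¬p i} → AddCircle (2 * π)) → AddCircle (2 * π) → ℝ),
      (∀ a y (θ : ℝ), ψ a y θ = ((θ + ∑ k, c a y k * sin (α a y k - θ) : ℝ) : AddCircle (2 * π))) ∧
      (∀ a y (θ : ℝ), jac a y θ = 1 - ∑ k, c a y k * cos (α a y k - θ)) := by
  choose F j hF hj using fun a y => exists_u1Layer_circle_real (c a y) (α a y)
  exact ⟨F, j, hF, hj⟩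

/-- The factor is positive and at least `1 − Σ_j |c_j|` at every point of the circle. -/
theorem u1Couple_jac_pos
    (c α : {i // p i} → ({i // ¬p i} → AddCircle (2 * π)) → Fin n → ℝ)
    (hκ : ∀ a y, ∑ k, |c a y k| < 1)
    {jac : {i // p i} → ({i // ¬p i} → AddCircle (2 * π)) → AddCircle (2 * π) → ℝ}
    (hjac : ∀ a y (θ : ℝ), jac a y θ = 1 - ∑ k, c a y k * cos (α a y k - θ))
    (a : {i // p i}) (y : {i // ¬p i} → AddCircle (2 * π)) (g : AddCircle (2 * π)) :
    0 < jac a y g ∧ 1 - ∑ k, |c a y k| ≤ jac a y g := by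
  refine AddCircle.forall_coe (P := fun g => 0 < jac a y g ∧ 1 - ∑ k, |c a y k| ≤ jac a y g)
    (fun θ => ?_) g
  simp only [hjac]
  exact ⟨u1LayerJac_pos (c a y) (α a y) (hκ a y) θ, (u1LayerJac_mem_Icc (c a y) (α a y) θ).1⟩

variable [hT : Fact (0 < 2 * π)] [Fintype ι] [DecidablePred p]

/-- **The engine's masked U(1) layer has exact Jacobian on the gauge-field configuration space.**
Links `ι → ℝ/2πℤ` with product Haar measure; active predicate `p`; coefficients / angles of each
active link's map = any measurable functions of the FROZEN links with contraction indicator `< 1`;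
single-link maps `ψ` and factors `jac` given on representatives by the engine's formulas.  Then
`Theory2.coupleFun p ψ` (the layer) has Jacobian `ofReal ∘ Theory2.coupleJac p jac`
(`= ∏_{active} (1 − C)`) w.r.t. `Measure.pi fun _ => volume`. -/
theorem hasJacobian_u1CoupleFun
    (c α : {i // p i} → ({i // ¬p i} → AddCircle (2 * π)) → Fin n → ℝ)
    (hc : ∀ a k, Measurable fun y => c a y k) (hα : ∀ a k, Measurable fun y => α a y k)
    (hκ : ∀ a y, ∑ k, |c a y k| < 1)
    {ψ : {i // p i} → ({i // ¬p i} → AddCircle (2 * π)) → AddCircle (2 * π) → AddCircle (2 * π)}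
    (hψ : ∀ a y (θ : ℝ), ψ a y θ = ((θ + ∑ k, c a y k * sin (α a y k - θ) : ℝ) : AddCircle (2 * π)))
    {jac : {i // p i} → ({i // ¬p i} → AddCircle (2 * π)) → AddCircle (2 * π) → ℝ}
    (hjac : ∀ a y (θ : ℝ), jac a y θ = 1 - ∑ k, c a y k * cos (α a y k - θ)) :
    HasJacobian (Measure.pi fun _ : ι => (volume : Measure (AddCircle (2 * π))))
      (coupleFun p ψ) fun U => ENNReal.ofReal (coupleJac p jac U) := by
  -- joint measurability in (link, frozen part), through representatives
  have hψm : ∀ a, Measurable fun q : AddCircle (2 * π) × ({i // ¬p i} → AddCircle (2 * π)) =>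
      ψ a q.2 q.1 := by
    intro a
    refine AddCircle.measurable_of_measurable_comp_coe_prod ?_
    simp_rw [hψ]
    exact AddCircle.measurable_mk'.comp (measurable_fst.add (Finset.measurable_sum _ fun k _ =>
      ((hc a k).comp measurable_snd).mul
        (measurable_sin.comp (((hα a k).comp measurable_snd).sub measurable_fst))))
  have hjm : ∀ a, Measurable fun q : AddCircle (2 * π) × ({i // ¬p i} → AddCircle (2 * π)) =>
      jac a q.2 q.1 := by
    intro a
    refine AddCircle.measurable_of_measurable_comp_coe_prod ?_
    simp_rw [hjac]
    exact measurable_const.sub (Finset.measurable_sum _ fun k _ =>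
      ((hc a k).comp measurable_snd).mul
        (measurable_cos.comp (((hα a k).comp measurable_snd).sub measurable_fst)))
  refine hasJacobian_coupleFun volume hψm hjm (fun a y => ?_) fun a y g =>
    (u1Couple_jac_pos c α hκ hjac a y g).1.le
  exact hasJacobian_u1Layer_circle (c a y) (α a y) (hκ a y) (hψ a y) fun θ => by
    simp only [hjac]

/-- **Summary / non-vacuity**: for every active predicate and every measurable frozen-link
environment with contraction indicator `< 1` the engine's U(1) layer exists as a coupling layer on
`ι → ℝ/2πℤ` with certified Jacobian `∏_{active} (1 − C)` for the product Haar measure. -/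
theorem exists_hasJacobian_u1CoupleFun
    (c α : {i // p i} → ({i // ¬p i} → AddCircle (2 * π)) → Fin n → ℝ)
    (hc : ∀ a k, Measurable fun y => c a y k) (hα : ∀ a k, Measurable fun y => α a y k)
    (hκ : ∀ a y, ∑ k, |c a y k| < 1) :
    ∃ (ψ : {i // p i} → ({i // ¬p i} → AddCircle (2 * π)) → AddCircle (2 * π) → AddCircle (2 * π))
      (jac : {i // p i} → ({i // ¬p i} → AddCircle (2 * π)) → AddCircle (2 * π) → ℝ),
      (∀ a y (θ : ℝ), ψ a y θ = ((θ + ∑ k, c a y k * sin (α a y k - θ) : ℝ) : AddCircle (2 * π))) ∧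
      (∀ a y (θ : ℝ), jac a y θ = 1 - ∑ k, c a y k * cos (α a y k - θ)) ∧
      HasJacobian (Measure.pi fun _ : ι => (volume : Measure (AddCircle (2 * π))))
        (coupleFun p ψ) fun U => ENNReal.ofReal (coupleJac p jac U) := by
  obtain ⟨ψ, jac, hψ, hjac⟩ := exists_u1Couple (n := n) c α
  exact ⟨ψ, jac, hψ, hjac, hasJacobian_u1CoupleFun c α hc hα hκ hψ hjac⟩

omit hT in
/-- **Per-link clamp ⟹ layer clamp** (row 31's depth-law input): a uniform indicator bound
`Σ_j |c a y j| ≤ κ₀ < 1` gives `1/jac ≤ e^{−log(1 − κ₀)}` per link, hence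
`1 / coupleJac ≤ e^{−log(1 − κ₀) · #active}` for the layer. -/
theorem u1CoupleJac_inv_le
    (c α : {i // p i} → ({i // ¬p i} → AddCircle (2 * π)) → Fin n → ℝ) {κ₀ : ℝ} (hκ₀ : κ₀ < 1)
    (hκ : ∀ a y, ∑ k, |c a y k| ≤ κ₀)
    {jac : {i // p i} → ({i // ¬p i} → AddCircle (2 * π)) → AddCircle (2 * π) → ℝ}
    (hjac : ∀ a y (θ : ℝ), jac a y θ = 1 - ∑ k, c a y k * cos (α a y k - θ))
    (U : ι → AddCircle (2 * π)) :
    (coupleJac p jac U)⁻¹ ≤ Real.exp (-Real.log (1 - κ₀) * Fintype.card {i // p i}) := by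
  have hκ' : ∀ a y, ∑ k, |c a y k| < 1 := fun a y => (hκ a y).trans_lt hκ₀
  have h1 : 0 < 1 - κ₀ := by linarith
  refine coupleJac_inv_le (fun a y g => (u1Couple_jac_pos c α hκ' hjac a y g).1)
    (fun a y g => ?_) U
  rw [Real.exp_neg, Real.exp_log h1]
  have hj := (u1Couple_jac_pos c α hκ' hjac a y g).2
  exact inv_anti₀ h1 (by linarith [hκ a y])

end U1Coupling

end Summit.Ventures.LatticeQCDFlow.Exactness
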